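import Literature.MathematicalPhysics.QuantumFieldTheory.Balaban1983to89.Node00.OpsYRecordV11
import Literature.MathematicalPhysics.QuantumFieldTheory.Balaban1983to89.B9Eq3115KnitLetterYOnto

/-!
# def-Y's v11 KNIT RECORD ON THE REGIME OF RECORD (3.35): (L6) «`Q(U)` onto» FOLDED BY NAME, the unit `(Q G₁ Q†)(U)`, the symmetric rows `G̃ ∕ G₁ ∕ 𝔊`,
# and the rows AT `G = SU(N)`, `𝔯 = resYOfRecordP` with only (3.138) displayed — Balaban, Commun. Math. Phys. **99** (1985) 389–434, (3.35) p.396,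
# (3.115) p.418, (3.122)–(3.138) pp.420–423, (3.152)–(3.153) p.426; Commun. Math. Phys. **98** (1985) 17–51, (139)–(147) pp.39–40

[cite: Balaban1985BackgroundPropagators, (3.35) p.396, (3.115) p.418, (3.122)–(3.126) p.420, (3.128)–(3.129) p.421, (3.132) p.422, (3.134) p.422, (3.138) p.423,
(3.152)–(3.153) p.426, (3.124) p.420, (3.24)–(3.25) p.394, p.420 («ω = (QGQ*)⁻¹B»), p.393 (Q* the adjoint of Q), p.389–390 (G ⊂ U(N))]
[cite: Balaban1985Averaging, Prop. 2 p.26, (15)–(23) pp.19–21, (139)–(147) pp.39–40]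

The v11 knit record `Node00.OpsYRecordV11.lettersYOfRecordV11K N θ Mstar 𝔯` (print's averaging `Q` of (3.115) = dag-n06-l's `QknitY`, its trace adjoint,
print's knit site transporter `parKnitY`, `G′_phys`, the residual family `𝔯`) displays, at a certificate, the law binders «`Q(U)` onto» (the unit
`(Q G₁ Q†)(U)`, p.420), «knit legs unitary» (`hpar`, the symmetric rows) and «`Δ⁽²⁾(U)` symmetric» (`hΔ2`).  On the REGIME OF RECORD
`OpsYQLetter.regQY G i c₀ α₀ U = (bg9KP _ G i).Reg335 c₀ α₀ U` ((3.35) over print's cube class) all three now have BY-NAME suppliers in the tree: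

* (L6) «`Q(U)` onto» = dag-n06-l's ★★★ `B9Eq3115KnitLetterYOnto.QknitY_surjective_of_reg335P` ([Balaban1985Averaging] (139)–(147): level-triangularity
  on the far-face rows + an injective diagonal under `K(d+1,L)·α₀′ < 1`) — §1 folds it into def-Y's law `IsOntoOnQ (regQY G i c₀ α₀) (qKnitOfRecord N θ i)`
  (`isOntoOnQ_qKnitOfRecord`), with the pointwise surjection and the injectivity of the adjoint letter `Q†(U)` (`injective_qsKnitOfRecord_of_regQY`);
* «knit legs unitary» = `OpsYQLetter.parKnitY_mem_unitary_of_regQY` (dag-n06-l's `parKnitY_mem_unitary_of_reg335P`) — §2 gives the v11 knit record's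
  `G₁ ∕ 𝔊` symmetric rows pointwise and on the regime (`lettersYOfRecordV11K_G₁_isSymmTr[_of_regQY]`, `…_GG_…`, the triple
  `lettersYOfRecordV11K_symmDG₁GG_of_regQY`; `G̃ = GD` is `OpsYRecordV11.lettersYOfRecordV11K_GD_isSymmTr_of_regQY`) and ★★★ the unit `(Q G₁ Q†)(U)` on the
  regime from `Δ⁽¹⁾(U) > 0` ALONE (`lettersYOfRecordV11K_isUnit_QGQOfQY_G₁_of_regQY`; the parSymY-keyed v10 knit record's twin
  `lettersYOfRecordV10K_isUnit_QGQOfQY_G₁_of_regQY`);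
* «`Δ⁽²⁾(U)` symmetric» at the record's residual family `resYOfRecordP` and `SU(N)`-valued backgrounds = def-Y's
  `OpsYC2OfRecord.resYOfRecordP_Δ2_isSymmTr_SU` — §3 is the v11 knit record AT `G := SU(N)`, `𝔯 := resYOfRecordP N θ Mstar`: `G̃ ∧ G₁ ∧ 𝔊` symmetric on
  the regime with NOTHING displayed but the regime's numerics (`lettersYOfRecordV11K_symmDG₁GG_SU_of_regQY`), the unit `(Q G₁ Q†)(U)` and (3.152) ∕ (3.124)
  with only (3.138) displayed (`…_isUnit_QGQOfQY_G₁_SU_of_regQY`, `…_ids3152_SU_of_regQY`), and (3.115)'s `Q D G′_phys R = 0` (`qKnitOfRecord_hZ_SU_of_regQY`);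
  `‖u‖ ≤ 1` on `G ≤ U(N)` is `unitBddY_of_le_unitaryUnits` (dag-n06-l's unit-boundedness binder `hG1` follows from `hGU`; `unitBddY_specialUnitaryUnits` at `SU(N)`).

The numerics are dag-n06-l's, verbatim and x-free except `0 ≤ M·α₀` and `K_pl(M·α₀)·L⁴ < α₀′`: for the symmetric ∕ (3.115) ∕ (3.152) rows `0 < α₀′`,
`C₀(d+1)·α₀′ ≤ 1/3`, `2α₀′ ≤ c₂′(d+1,L)`; for the onto ∕ unit rows `0 < α₀′ ≤ α_Q(d+1,L)`, `K(d+1,L)·α₀′ < 1` (`B9Eq3115KnitLetterYOnto.kCol`); `c₀ ≤ 10`.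

HONEST STATUS.  Bookkeeping over landed theorems (dag-n06-l's (L6), (3.35)-unitarity of the knit legs, def-Y's v11 record and residual symmetry); no
estimate of [B9] is asserted here; (3.138) (`Δ⁽¹⁾(U) > 0` ∕ `G₁⁻¹(U)` invertible) stays the displayed hypothesis `hΔ1 ∕ hM1`; print's units `c_f η = 1`
stay the displayed `hcf`.  0 `sorry`.
-/

namespace Literature.MathematicalPhysics.QuantumFieldTheory.Balaban1983to89.Node00

open B6KLevelCensusIndexV1 (KIdx kGeo)
open B9PinMembersKLevelV1 (MemberY geo9Y)
open B7Prop2SpecialUnitary (specialUnitaryUnits specialUnitaryUnits_le_unitaryUnits)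
open B7Prop2Explicit (C0 c2')
open B9C2FormBoxRegimeY (Kpl)
open B9Eq316AveragingTransposeZd (alphaQ)
open B9Eq3115KnitLetterYOnto (kCol QknitY_surjective_of_reg335P)
open B9Thm311ReadingCoords (IsSymmTr IsAdjTr PosDefTr)
open B9B8AveragingJunction (parKnitY)
open OpsYQLetter (QLetterY QsLetterY RegimeY QFamY QsFamY IsOntoOnQ regQY mem_of_regQY parKnitY_mem_unitary_of_regQY qKnitOfRecord qsKnitOfRecord
  isNullOnQ_qKnitOfRecord)
open scoped Matrix Matrix.Norms.L2Operator

variable {d ℓ : ℕ} {hd : 1 ≤ d + 1} {hL : Odd (ℓ + 1) ∧ 1 < ℓ + 1} {b₀ b₁ : ℝ} {Mstar : ℕ}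

/-! ## §0 `‖u‖ ≤ 1` on a subgroup of `U(N)` (dag-n06-l's `hG1` from `hGU`) -/

section Norm

variable {N : ℕ} [Nonempty (Fin N)] {G : Subgroup (Matrix (Fin N) (Fin N) ℂ)ˣ}

/-- every element of a subgroup `G ≤ U(N)` has operator norm `≤ 1` (indeed `= 1`): dag-n06-l's unit-boundedness binder `hG1` follows from `hGU`.
[cite: Balaban1985BackgroundPropagators, pp.389–390 (G ⊂ U(N))] [cite: Balaban1985Averaging, (19) p.21 («|u| ≦ 1»)] -/
theorem unitBddY_of_le_unitaryUnits (hGU : G ≤ B7Prop2Explicit.unitaryUnits (Matrix (Fin N) (Fin N) ℂ)) :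
    ∀ u : (Matrix (Fin N) (Fin N) ℂ)ˣ, u ∈ G → ‖(u : Matrix (Fin N) (Fin N) ℂ)‖ ≤ 1 :=
  fun _ hu => (CStarRing.norm_of_mem_unitary (B7Prop2Explicit.mem_unitaryUnits.1 (hGU hu))).le

/-- in particular on `SU(N)`. [cite: Balaban1985BackgroundPropagators, pp.389–390 (G ⊂ U(N)), bookkeeping] -/
theorem unitBddY_specialUnitaryUnits :
    ∀ u : (Matrix (Fin N) (Fin N) ℂ)ˣ, u ∈ specialUnitaryUnits (Fin N) → ‖(u : Matrix (Fin N) (Fin N) ℂ)‖ ≤ 1 :=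
  unitBddY_of_le_unitaryUnits specialUnitaryUnits_le_unitaryUnits

end Norm

/-! ## §1 (L6) «`Q(U)` onto on (3.35)» for the knit family of record, by name (dag-n06-l), and the injectivity of `Q†(U)` -/

section OntoLaw

variable {N : ℕ} [Nonempty (Fin N)] {θ : Stage3Params} {G : Subgroup (Matrix (Fin N) (Fin N) ℂ)ˣ}

/-- ★★★ (L6) **PRINT's AVERAGING OF RECORD IS ONTO ON THE REGIME OF RECORD**: `IsOntoOnQ (regQY G i c₀ α₀) (qKnitOfRecord N θ i)` for `G ≤ U(N)` unit-bounded,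
`c₀ ≤ 10`, `0 ≤ Mα₀`, under the x-free numerics `0 < α₀′ ≤ α_Q(d+1,L)`, `K_pl(Mα₀)·L⁴ < α₀′`, `K(d+1,L)·α₀′ < 1` — dag-n06-l's
`B9Eq3115KnitLetterYOnto.QknitY_surjective_of_reg335P` by name (`qKnitOfRecord N θ i U = QknitY i U`, `regQY = (bg9KP …).Reg335`, both `rfl`).
[cite: Balaban1985BackgroundPropagators, p.420 («ω = (QGQ*)⁻¹B»), (3.123)–(3.126) p.420, (3.35) p.396] [cite: Balaban1985Averaging, (139)–(147) pp.39–40, (15) p.19] -/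
theorem isOntoOnQ_qKnitOfRecord (hG1 : ∀ u : (Matrix (Fin N) (Fin N) ℂ)ˣ, u ∈ G → ‖(u : Matrix (Fin N) (Fin N) ℂ)‖ ≤ 1)
    (hGU : G ≤ B7Prop2Explicit.unitaryUnits (Matrix (Fin N) (Fin N) ℂ)) {c₀ α₀ : ℝ} (hc : c₀ ≤ 10) (i : KIdx θ.d₆ θ.ℓ₆ θ.hd' θ.hL' θ.b₀ θ.b₁)
    (hMα : 0 ≤ (kGeo i).M * α₀) {α₀' : ℝ} (hα' : 0 < α₀') (hαQ : α₀' ≤ alphaQ (θ.d₆ + 1) (θ.ℓ₆ + 1))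
    (hK : Kpl i ((kGeo i).M * α₀) * (kGeo i).L ^ 4 < α₀') (hsmall : kCol (θ.d₆ + 1) (θ.ℓ₆ + 1) * α₀' < 1) :
    IsOntoOnQ (regQY G i c₀ α₀) (qKnitOfRecord N θ i) :=
  fun _ hU => QknitY_surjective_of_reg335P i hG1 hGU hc hMα hU hα' hαQ hK hsmall

/-- ★★ pointwise: `Q(U) = qKnitOfRecord N θ i U` is SURJECTIVE at every background of the regime of record. [cite: Balaban1985BackgroundPropagators, p.420, (3.35) p.396] [cite: Balaban1985Averaging, (139)–(147) pp.39–40] -/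
theorem surjective_qKnitOfRecord_of_regQY (hG1 : ∀ u : (Matrix (Fin N) (Fin N) ℂ)ˣ, u ∈ G → ‖(u : Matrix (Fin N) (Fin N) ℂ)‖ ≤ 1)
    (hGU : G ≤ B7Prop2Explicit.unitaryUnits (Matrix (Fin N) (Fin N) ℂ)) {c₀ α₀ : ℝ} (hc : c₀ ≤ 10) (i : KIdx θ.d₆ θ.ℓ₆ θ.hd' θ.hL' θ.b₀ θ.b₁)
    (hMα : 0 ≤ (kGeo i).M * α₀) {α₀' : ℝ} (hα' : 0 < α₀') (hαQ : α₀' ≤ alphaQ (θ.d₆ + 1) (θ.ℓ₆ + 1))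
    (hK : Kpl i ((kGeo i).M * α₀) * (kGeo i).L ^ 4 < α₀') (hsmall : kCol (θ.d₆ + 1) (θ.ℓ₆ + 1) * α₀' < 1)
    {U : CfgY (Matrix (Fin N) (Fin N) ℂ) i} (hU : regQY G i c₀ α₀ U) : Function.Surjective (qKnitOfRecord N θ i U) :=
  isOntoOnQ_qKnitOfRecord hG1 hGU hc i hMα hα' hαQ hK hsmall U hU

/-- ★★ hence the ADJOINT LETTER `Q†(U) = qsKnitOfRecord N θ i U` is INJECTIVE on the regime (adjoint of a surjection for positive-definite pairings —
the injectivity half of the certificate's `hUQ`). [cite: Balaban1985BackgroundPropagators, (3.128) p.421, p.393 (Q* the adjoint of Q), (3.35) p.396] [cite: Balaban1985Averaging, (139)–(147) pp.39–40] -/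
theorem injective_qsKnitOfRecord_of_regQY (hG1 : ∀ u : (Matrix (Fin N) (Fin N) ℂ)ˣ, u ∈ G → ‖(u : Matrix (Fin N) (Fin N) ℂ)‖ ≤ 1)
    (hGU : G ≤ B7Prop2Explicit.unitaryUnits (Matrix (Fin N) (Fin N) ℂ)) {c₀ α₀ : ℝ} (hc : c₀ ≤ 10) (i : KIdx θ.d₆ θ.ℓ₆ θ.hd' θ.hL' θ.b₀ θ.b₁)
    (hMα : 0 ≤ (kGeo i).M * α₀) {α₀' : ℝ} (hα' : 0 < α₀') (hαQ : α₀' ≤ alphaQ (θ.d₆ + 1) (θ.ℓ₆ + 1))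
    (hK : Kpl i ((kGeo i).M * α₀) * (kGeo i).L ^ 4 < α₀') (hsmall : kCol (θ.d₆ + 1) (θ.ℓ₆ + 1) * α₀' < 1)
    {U : CfgY (Matrix (Fin N) (Fin N) ℂ) i} (hU : regQY G i c₀ α₀ U) : Function.Injective (qsKnitOfRecord N θ i U) :=
  injective_of_isAdjTr_of_surjective (fun _ => one_pos) (isAdjTr_qKnitOfRecord i U)
    (surjective_qKnitOfRecord_of_regQY hG1 hGU hc i hMα hα' hαQ hK hsmall hU)

/-- ★ and `Q(U)` has a LINEAR RIGHT INVERSE on the regime (`Q(U) ∘ S = 1`). [cite: Balaban1985BackgroundPropagators, p.420, (3.35) p.396] [cite: Balaban1985Averaging, (139)–(147) pp.39–40] -/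
theorem exists_rightInverse_qKnitOfRecord_of_regQY (hG1 : ∀ u : (Matrix (Fin N) (Fin N) ℂ)ˣ, u ∈ G → ‖(u : Matrix (Fin N) (Fin N) ℂ)‖ ≤ 1)
    (hGU : G ≤ B7Prop2Explicit.unitaryUnits (Matrix (Fin N) (Fin N) ℂ)) {c₀ α₀ : ℝ} (hc : c₀ ≤ 10) (i : KIdx θ.d₆ θ.ℓ₆ θ.hd' θ.hL' θ.b₀ θ.b₁)
    (hMα : 0 ≤ (kGeo i).M * α₀) {α₀' : ℝ} (hα' : 0 < α₀') (hαQ : α₀' ≤ alphaQ (θ.d₆ + 1) (θ.ℓ₆ + 1))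
    (hK : Kpl i ((kGeo i).M * α₀) * (kGeo i).L ^ 4 < α₀') (hsmall : kCol (θ.d₆ + 1) (θ.ℓ₆ + 1) * α₀' < 1)
    {U : CfgY (Matrix (Fin N) (Fin N) ℂ) i} (hU : regQY G i c₀ α₀ U) :
    ∃ S : (IBondY i → Matrix (Fin N) (Fin N) ℂ) →ₗ[ℂ] (FBondY i → Matrix (Fin N) (Fin N) ℂ), qKnitOfRecord N θ i U ∘ₗ S = LinearMap.id :=
  (qKnitOfRecord N θ i U).exists_rightInverse_of_surjective
    (LinearMap.range_eq_top.2 (surjective_qKnitOfRecord_of_regQY hG1 hGU hc i hMα hα' hαQ hK hsmall hU))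

end OntoLaw

/-! ## §2 The v11 knit record's `G₁ ∕ 𝔊` symmetric rows and the unit `(Q G₁ Q†)(U)` on the regime of record -/

section RecordKnit

variable (N : ℕ) [Nonempty (Fin N)] (θ : Stage3Params) (Mstar : ℕ) (𝔯 : ResY N θ Mstar)
variable {G : Subgroup (Matrix (Fin N) (Fin N) ℂ)ˣ}

/-- ★★ **THE v11 KNIT RECORD'S `G₁` IS SYMMETRIC** at every `G`-valued background (`G ≤ U(N)`) with `G`-valued knit legs and `(𝔯 x).Δ2 U` symmetric (the
adjointness of the knit pair by construction). [cite: Balaban1985BackgroundPropagators, (3.128)–(3.129) p.421, (3.35) p.396] [cite: Balaban1985Averaging, (15) p.19, Prop. 2 p.26] -/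
theorem lettersYOfRecordV11K_G₁_isSymmTr (hG : G ≤ B7Prop2Explicit.unitaryUnits (Matrix (Fin N) (Fin N) ℂ))
    (x : MemberY θ.d₆ θ.ℓ₆ θ.hd' θ.hL' θ.b₀ θ.b₁ Mstar) {U : CfgY (Matrix (Fin N) (Fin N) ℂ) x.toKIdx} (hU : ∀ μ z, U μ z ∈ G)
    (hpar : ∀ z w : SiteY x.toKIdx, parKnitY x.toKIdx U z w ∈ G) (hΔ2 : IsSymmTr (fun _ => (1 : ℝ)) ((𝔯 x).Δ2 U)) :
    IsSymmTr (fun _ => (1 : ℝ)) ((lettersYOfRecordV11K N θ Mstar 𝔯 x).G₁ U) :=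
  lettersYOfRecordV11_G₁_isSymmTr N θ Mstar (qKnitOfRecord N θ) (qsKnitOfRecord N θ) (qKnitOfRecord_flat N θ) (qsKnitOfRecord_flat N θ) 𝔯 hG x hU
    hpar (isAdjTr_qKnitOfRecord x.toKIdx U) hΔ2

/-- ★★ **THE v11 KNIT RECORD'S `GG = 𝔊` IS SYMMETRIC** under the same hypotheses. [cite: Balaban1985BackgroundPropagators, (3.153) p.426, (3.35) p.396] [cite: Balaban1985Averaging, (15) p.19, Prop. 2 p.26] -/
theorem lettersYOfRecordV11K_GG_isSymmTr (hG : G ≤ B7Prop2Explicit.unitaryUnits (Matrix (Fin N) (Fin N) ℂ))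
    (x : MemberY θ.d₆ θ.ℓ₆ θ.hd' θ.hL' θ.b₀ θ.b₁ Mstar) {U : CfgY (Matrix (Fin N) (Fin N) ℂ) x.toKIdx} (hU : ∀ μ z, U μ z ∈ G)
    (hpar : ∀ z w : SiteY x.toKIdx, parKnitY x.toKIdx U z w ∈ G) (hΔ2 : IsSymmTr (fun _ => (1 : ℝ)) ((𝔯 x).Δ2 U)) :
    IsSymmTr (fun _ => (1 : ℝ)) ((lettersYOfRecordV11K N θ Mstar 𝔯 x).GG U) :=
  lettersYOfRecordV11_GG_isSymmTr N θ Mstar (qKnitOfRecord N θ) (qsKnitOfRecord N θ) (qKnitOfRecord_flat N θ) (qsKnitOfRecord_flat N θ) 𝔯 hG x hU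
    hpar (isAdjTr_qKnitOfRecord x.toKIdx U) hΔ2

/-- ★★ **ON THE REGIME OF RECORD THE v11 KNIT RECORD'S `G₁` IS SYMMETRIC given only `(𝔯 x).Δ2 U` symmetric** (`G ≤ U(N)` unit-bounded, `c₀ ≤ 10`, `0 ≤ Mα₀`,
the x-free numerics): the knit legs are unitary there (`parKnitY_mem_unitary_of_regQY`), take `G := U(N)`.
[cite: Balaban1985BackgroundPropagators, (3.128)–(3.129) p.421, (3.35) p.396] [cite: Balaban1985Averaging, Prop. 2 p.26, (15) p.19] -/
theorem lettersYOfRecordV11K_G₁_isSymmTr_of_regQY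
    (hG1 : ∀ u : (Matrix (Fin N) (Fin N) ℂ)ˣ, u ∈ G → ‖(u : Matrix (Fin N) (Fin N) ℂ)‖ ≤ 1) (hGU : G ≤ B7Prop2Explicit.unitaryUnits (Matrix (Fin N) (Fin N) ℂ))
    {c₀ α₀ : ℝ} (hc : c₀ ≤ 10) (x : MemberY θ.d₆ θ.ℓ₆ θ.hd' θ.hL' θ.b₀ θ.b₁ Mstar) (hMα : 0 ≤ (kGeo x.toKIdx).M * α₀) {α₀' : ℝ} (hα' : 0 < α₀')
    (hα3 : C0 (θ.d₆ + 1) * α₀' ≤ 1 / 3) (hα2 : 2 * α₀' ≤ c2' (θ.d₆ + 1) (θ.ℓ₆ + 1)) (hK : Kpl x.toKIdx ((kGeo x.toKIdx).M * α₀) * (kGeo x.toKIdx).L ^ 4 < α₀')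
    {U : CfgY (Matrix (Fin N) (Fin N) ℂ) x.toKIdx} (hU : regQY G x.toKIdx c₀ α₀ U) (hΔ2 : IsSymmTr (fun _ => (1 : ℝ)) ((𝔯 x).Δ2 U)) :
    IsSymmTr (fun _ => (1 : ℝ)) ((lettersYOfRecordV11K N θ Mstar 𝔯 x).G₁ U) :=
  lettersYOfRecordV11K_G₁_isSymmTr N θ Mstar 𝔯 (G := B7Prop2Explicit.unitaryUnits _) le_rfl x (fun μ z => hGU (mem_of_regQY (i := x.toKIdx) hU μ z))
    (parKnitY_mem_unitary_of_regQY x.toKIdx hG1 hGU hc hMα hα' hα3 hα2 hK hU) hΔ2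

/-- ★★ **ON THE REGIME OF RECORD THE v11 KNIT RECORD'S `GG = 𝔊` IS SYMMETRIC given only `(𝔯 x).Δ2 U` symmetric.**
[cite: Balaban1985BackgroundPropagators, (3.153) p.426, (3.35) p.396] [cite: Balaban1985Averaging, Prop. 2 p.26, (15) p.19] -/
theorem lettersYOfRecordV11K_GG_isSymmTr_of_regQY
    (hG1 : ∀ u : (Matrix (Fin N) (Fin N) ℂ)ˣ, u ∈ G → ‖(u : Matrix (Fin N) (Fin N) ℂ)‖ ≤ 1) (hGU : G ≤ B7Prop2Explicit.unitaryUnits (Matrix (Fin N) (Fin N) ℂ))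
    {c₀ α₀ : ℝ} (hc : c₀ ≤ 10) (x : MemberY θ.d₆ θ.ℓ₆ θ.hd' θ.hL' θ.b₀ θ.b₁ Mstar) (hMα : 0 ≤ (kGeo x.toKIdx).M * α₀) {α₀' : ℝ} (hα' : 0 < α₀')
    (hα3 : C0 (θ.d₆ + 1) * α₀' ≤ 1 / 3) (hα2 : 2 * α₀' ≤ c2' (θ.d₆ + 1) (θ.ℓ₆ + 1)) (hK : Kpl x.toKIdx ((kGeo x.toKIdx).M * α₀) * (kGeo x.toKIdx).L ^ 4 < α₀')
    {U : CfgY (Matrix (Fin N) (Fin N) ℂ) x.toKIdx} (hU : regQY G x.toKIdx c₀ α₀ U) (hΔ2 : IsSymmTr (fun _ => (1 : ℝ)) ((𝔯 x).Δ2 U)) :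
    IsSymmTr (fun _ => (1 : ℝ)) ((lettersYOfRecordV11K N θ Mstar 𝔯 x).GG U) :=
  lettersYOfRecordV11K_GG_isSymmTr N θ Mstar 𝔯 (G := B7Prop2Explicit.unitaryUnits _) le_rfl x (fun μ z => hGU (mem_of_regQY (i := x.toKIdx) hU μ z))
    (parKnitY_mem_unitary_of_regQY x.toKIdx hG1 hGU hc hMα hα' hα3 hα2 hK hU) hΔ2

/-- ★★★ **THE CERTIFICATE's `hsymD` ON THE REGIME OF RECORD** for the v11 knit record: `G̃ ∧ G₁ ∧ 𝔊` symmetric at every background of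
`regQY G x c₀ α₀`, given only `(𝔯 x).Δ2 U` symmetric — «knit legs unitary» and «pair adjoint» DISCHARGED.
[cite: Balaban1985BackgroundPropagators, (3.122) p.420, (3.128) p.421, (3.153) p.426, (3.35) p.396] [cite: Balaban1985Averaging, Prop. 2 p.26, (15) p.19] -/
theorem lettersYOfRecordV11K_symmDG₁GG_of_regQY
    (hG1 : ∀ u : (Matrix (Fin N) (Fin N) ℂ)ˣ, u ∈ G → ‖(u : Matrix (Fin N) (Fin N) ℂ)‖ ≤ 1) (hGU : G ≤ B7Prop2Explicit.unitaryUnits (Matrix (Fin N) (Fin N) ℂ))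
    {c₀ α₀ : ℝ} (hc : c₀ ≤ 10) (x : MemberY θ.d₆ θ.ℓ₆ θ.hd' θ.hL' θ.b₀ θ.b₁ Mstar) (hMα : 0 ≤ (kGeo x.toKIdx).M * α₀) {α₀' : ℝ} (hα' : 0 < α₀')
    (hα3 : C0 (θ.d₆ + 1) * α₀' ≤ 1 / 3) (hα2 : 2 * α₀' ≤ c2' (θ.d₆ + 1) (θ.ℓ₆ + 1)) (hK : Kpl x.toKIdx ((kGeo x.toKIdx).M * α₀) * (kGeo x.toKIdx).L ^ 4 < α₀')
    {U : CfgY (Matrix (Fin N) (Fin N) ℂ) x.toKIdx} (hU : regQY G x.toKIdx c₀ α₀ U) (hΔ2 : IsSymmTr (fun _ => (1 : ℝ)) ((𝔯 x).Δ2 U)) :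
    IsSymmTr (fun _ => (1 : ℝ)) ((lettersYOfRecordV11K N θ Mstar 𝔯 x).GD U) ∧ IsSymmTr (fun _ => (1 : ℝ)) ((lettersYOfRecordV11K N θ Mstar 𝔯 x).G₁ U) ∧
      IsSymmTr (fun _ => (1 : ℝ)) ((lettersYOfRecordV11K N θ Mstar 𝔯 x).GG U) :=
  ⟨lettersYOfRecordV11K_GD_isSymmTr_of_regQY N θ Mstar 𝔯 hG1 hGU hc x hMα hα' hα3 hα2 hK hU,
    lettersYOfRecordV11K_G₁_isSymmTr_of_regQY N θ Mstar 𝔯 hG1 hGU hc x hMα hα' hα3 hα2 hK hU hΔ2,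
    lettersYOfRecordV11K_GG_isSymmTr_of_regQY N θ Mstar 𝔯 hG1 hGU hc x hMα hα' hα3 hα2 hK hU hΔ2⟩

/-- ★★★ **THE UNIT `(Q G₁ Q†)(U)` AT THE v11 KNIT RECORD ON THE REGIME OF RECORD FROM `Δ⁽¹⁾(U) > 0` ALONE** — «`Q(U)` onto» DISCHARGED by (L6)
(`surjective_qKnitOfRecord_of_regQY`, dag-n06-l), adjointness by construction; `G ≤ U(N)` unit-bounded, `c₀ ≤ 10`, `0 ≤ Mα₀`, `0 < α₀′ ≤ α_Q`,
`K_pl(Mα₀)·L⁴ < α₀′`, `K(d+1,L)·α₀′ < 1`. [cite: Balaban1985BackgroundPropagators, (3.132) p.422, (3.128) p.421, (3.138) p.423, p.420, (3.35) p.396] [cite: Balaban1985Averaging, (139)–(147) pp.39–40] -/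
theorem lettersYOfRecordV11K_isUnit_QGQOfQY_G₁_of_regQY
    (hG1 : ∀ u : (Matrix (Fin N) (Fin N) ℂ)ˣ, u ∈ G → ‖(u : Matrix (Fin N) (Fin N) ℂ)‖ ≤ 1) (hGU : G ≤ B7Prop2Explicit.unitaryUnits (Matrix (Fin N) (Fin N) ℂ))
    {c₀ α₀ : ℝ} (hc : c₀ ≤ 10) (x : MemberY θ.d₆ θ.ℓ₆ θ.hd' θ.hL' θ.b₀ θ.b₁ Mstar) (hMα : 0 ≤ (kGeo x.toKIdx).M * α₀) {α₀' : ℝ} (hα' : 0 < α₀')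
    (hαQ : α₀' ≤ alphaQ (θ.d₆ + 1) (θ.ℓ₆ + 1)) (hK : Kpl x.toKIdx ((kGeo x.toKIdx).M * α₀) * (kGeo x.toKIdx).L ^ 4 < α₀')
    (hsmall : kCol (θ.d₆ + 1) (θ.ℓ₆ + 1) * α₀' < 1) {U : CfgY (Matrix (Fin N) (Fin N) ℂ) x.toKIdx} (hU : regQY G x.toKIdx c₀ α₀ U)
    (hΔ1 : PosDefTr (fun _ => (1 : ℝ)) (deltaOneQY x.toKIdx (qKnitOfRecord N θ x.toKIdx) (qsKnitOfRecord N θ x.toKIdx) (parKnitY x.toKIdx)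
      (GpPhysY x.toKIdx (parKnitY x.toKIdx)) (𝔯 x).Δ2 U)) :
    IsUnit (QGQOfQY x.toKIdx (qKnitOfRecord N θ x.toKIdx) (qsKnitOfRecord N θ x.toKIdx) (lettersYOfRecordV11K N θ Mstar 𝔯 x).G₁ U) :=
  lettersYOfRecordV11K_isUnit_QGQOfQY_G₁ N θ Mstar 𝔯 x (surjective_qKnitOfRecord_of_regQY hG1 hGU hc x.toKIdx hMα hα' hαQ hK hsmall hU) hΔ1

/-- ★★ the parSymY-keyed v10 knit record's twin: the unit `(Q G₁ Q†)(U)` of `lettersYOfRecordV10K` on the regime of record from `Δ⁽¹⁾(U) > 0` alone.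
[cite: Balaban1985BackgroundPropagators, (3.132) p.422, (3.128) p.421, (3.138) p.423, p.420, (3.35) p.396] [cite: Balaban1985Averaging, (139)–(147) pp.39–40] -/
theorem lettersYOfRecordV10K_isUnit_QGQOfQY_G₁_of_regQY
    (hG1 : ∀ u : (Matrix (Fin N) (Fin N) ℂ)ˣ, u ∈ G → ‖(u : Matrix (Fin N) (Fin N) ℂ)‖ ≤ 1) (hGU : G ≤ B7Prop2Explicit.unitaryUnits (Matrix (Fin N) (Fin N) ℂ))
    {c₀ α₀ : ℝ} (hc : c₀ ≤ 10) (x : MemberY θ.d₆ θ.ℓ₆ θ.hd' θ.hL' θ.b₀ θ.b₁ Mstar) (hMα : 0 ≤ (kGeo x.toKIdx).M * α₀) {α₀' : ℝ} (hα' : 0 < α₀')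
    (hαQ : α₀' ≤ alphaQ (θ.d₆ + 1) (θ.ℓ₆ + 1)) (hK : Kpl x.toKIdx ((kGeo x.toKIdx).M * α₀) * (kGeo x.toKIdx).L ^ 4 < α₀')
    (hsmall : kCol (θ.d₆ + 1) (θ.ℓ₆ + 1) * α₀' < 1) {U : CfgY (Matrix (Fin N) (Fin N) ℂ) x.toKIdx} (hU : regQY G x.toKIdx c₀ α₀ U)
    (hΔ1 : PosDefTr (fun _ => (1 : ℝ)) (deltaOneQY x.toKIdx (qKnitOfRecord N θ x.toKIdx) (qsKnitOfRecord N θ x.toKIdx) (parSymY x.toKIdx)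
      (GpPhysY x.toKIdx (parSymY x.toKIdx)) (𝔯 x).Δ2 U)) :
    IsUnit (QGQOfQY x.toKIdx (qKnitOfRecord N θ x.toKIdx) (qsKnitOfRecord N θ x.toKIdx) (lettersYOfRecordV10K N θ Mstar 𝔯 x).G₁ U) :=
  lettersYOfRecordV10K_isUnit_QGQOfQY_G₁ N θ Mstar 𝔯 x (surjective_qKnitOfRecord_of_regQY hG1 hGU hc x.toKIdx hMα hα' hαQ hK hsmall hU) hΔ1

end RecordKnit

/-! ## §3 ★★★ The v11 knit record AT `G := SU(N)`, `𝔯 := resYOfRecordP`: only the regime's numerics and (3.138) displayed -/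

section AtRecord

variable (N : ℕ) [Nonempty (Fin N)] (θ : Stage3Params) (Mstar : ℕ)

/-- ★★★ **THE CERTIFICATE's `hsymD` AT THE RECORD OF RECORD WITH NOTHING DISPLAYED BUT THE REGIME**: at `G := SU(N)` and the residual family of record
`𝔯 := resYOfRecordP N θ Mstar`, the v11 knit record's `G̃ ∧ G₁ ∧ 𝔊` are symmetric at every background of `regQY SU(N) x c₀ α₀` (`c₀ ≤ 10`, `0 ≤ Mα₀`,
`0 < α₀′`, `C₀α₀′ ≤ 1/3`, `2α₀′ ≤ c₂′`, `K_pl(Mα₀)·L⁴ < α₀′`) — unit-boundedness of `SU(N)`, the knit legs' unitarity, the pair's adjointness and the residual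
symmetry `OpsYC2OfRecord.resYOfRecordP_Δ2_isSymmTr_SU` all by name.
[cite: Balaban1985BackgroundPropagators, (3.122) p.420, (3.128) p.421, (3.134) p.422, (3.153) p.426, (3.35) p.396, pp.389–390 (G ⊂ U(N))] [cite: Balaban1985Averaging, Prop. 2 p.26, (15) p.19] -/
theorem lettersYOfRecordV11K_symmDG₁GG_SU_of_regQY {c₀ α₀ : ℝ} (hc : c₀ ≤ 10) (x : MemberY θ.d₆ θ.ℓ₆ θ.hd' θ.hL' θ.b₀ θ.b₁ Mstar)
    (hMα : 0 ≤ (kGeo x.toKIdx).M * α₀) {α₀' : ℝ} (hα' : 0 < α₀') (hα3 : C0 (θ.d₆ + 1) * α₀' ≤ 1 / 3) (hα2 : 2 * α₀' ≤ c2' (θ.d₆ + 1) (θ.ℓ₆ + 1))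
    (hK : Kpl x.toKIdx ((kGeo x.toKIdx).M * α₀) * (kGeo x.toKIdx).L ^ 4 < α₀') {U : CfgY (Matrix (Fin N) (Fin N) ℂ) x.toKIdx}
    (hU : regQY (specialUnitaryUnits (Fin N)) x.toKIdx c₀ α₀ U) :
    IsSymmTr (fun _ => (1 : ℝ)) ((lettersYOfRecordV11K N θ Mstar (resYOfRecordP N θ Mstar) x).GD U) ∧
      IsSymmTr (fun _ => (1 : ℝ)) ((lettersYOfRecordV11K N θ Mstar (resYOfRecordP N θ Mstar) x).G₁ U) ∧
        IsSymmTr (fun _ => (1 : ℝ)) ((lettersYOfRecordV11K N θ Mstar (resYOfRecordP N θ Mstar) x).GG U) :=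
  lettersYOfRecordV11K_symmDG₁GG_of_regQY N θ Mstar (resYOfRecordP N θ Mstar) unitBddY_specialUnitaryUnits
    specialUnitaryUnits_le_unitaryUnits hc x hMα hα' hα3 hα2 hK hU (resYOfRecordP_Δ2_isSymmTr_SU N θ Mstar x U (mem_of_regQY (i := x.toKIdx) hU))

/-- ★★★ **THE UNIT `(Q G₁ Q†)(U)` AT THE RECORD OF RECORD FROM (3.138) ALONE**: at `G := SU(N)`, `𝔯 := resYOfRecordP N θ Mstar`, on the regime of record
(`c₀ ≤ 10`, `0 ≤ Mα₀`, `0 < α₀′ ≤ α_Q`, `K_pl(Mα₀)·L⁴ < α₀′`, `K(d+1,L)·α₀′ < 1`), given only `Δ⁽¹⁾(U) > 0`.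
[cite: Balaban1985BackgroundPropagators, (3.132) p.422, (3.138) p.423, p.420 («ω = (QGQ*)⁻¹B»), (3.35) p.396] [cite: Balaban1985Averaging, (139)–(147) pp.39–40] -/
theorem lettersYOfRecordV11K_isUnit_QGQOfQY_G₁_SU_of_regQY {c₀ α₀ : ℝ} (hc : c₀ ≤ 10) (x : MemberY θ.d₆ θ.ℓ₆ θ.hd' θ.hL' θ.b₀ θ.b₁ Mstar)
    (hMα : 0 ≤ (kGeo x.toKIdx).M * α₀) {α₀' : ℝ} (hα' : 0 < α₀') (hαQ : α₀' ≤ alphaQ (θ.d₆ + 1) (θ.ℓ₆ + 1))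
    (hK : Kpl x.toKIdx ((kGeo x.toKIdx).M * α₀) * (kGeo x.toKIdx).L ^ 4 < α₀') (hsmall : kCol (θ.d₆ + 1) (θ.ℓ₆ + 1) * α₀' < 1)
    {U : CfgY (Matrix (Fin N) (Fin N) ℂ) x.toKIdx} (hU : regQY (specialUnitaryUnits (Fin N)) x.toKIdx c₀ α₀ U)
    (hΔ1 : PosDefTr (fun _ => (1 : ℝ)) (deltaOneQY x.toKIdx (qKnitOfRecord N θ x.toKIdx) (qsKnitOfRecord N θ x.toKIdx) (parKnitY x.toKIdx)
      (GpPhysY x.toKIdx (parKnitY x.toKIdx)) (resYOfRecordP N θ Mstar x).Δ2 U)) :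
    IsUnit (QGQOfQY x.toKIdx (qKnitOfRecord N θ x.toKIdx) (qsKnitOfRecord N θ x.toKIdx) (lettersYOfRecordV11K N θ Mstar (resYOfRecordP N θ Mstar) x).G₁ U) :=
  lettersYOfRecordV11K_isUnit_QGQOfQY_G₁_of_regQY N θ Mstar (resYOfRecordP N θ Mstar) unitBddY_specialUnitaryUnits
    specialUnitaryUnits_le_unitaryUnits hc x hMα hα' hαQ hK hsmall hU hΔ1

/-- ★★ (3.115)'s consequence **`Q(U) D_U G′_phys(U) R(U) = 0` AT `G := SU(N)`** for print's averaging of record over print's knit transporter, on the regime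
of record (the certificate's `hZ` row; dag-n06-l's theorem, `OpsYQLetter.isNullOnQ_qKnitOfRecord` with `SU(N)`'s unit-boundedness by name).
[cite: Balaban1985BackgroundPropagators, (3.115) p.418, (3.121)–(3.125) p.420, (3.35) p.396] [cite: Balaban1985Averaging, Prop. 2 p.26] -/
theorem qKnitOfRecord_hZ_SU_of_regQY {c₀ α₀ : ℝ} (hc : c₀ ≤ 10) (i : KIdx θ.d₆ θ.ℓ₆ θ.hd' θ.hL' θ.b₀ θ.b₁) (hMα : 0 ≤ (kGeo i).M * α₀) {α₀' : ℝ}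
    (hα' : 0 < α₀') (hα3 : C0 (θ.d₆ + 1) * α₀' ≤ 1 / 3) (hα2 : 2 * α₀' ≤ c2' (θ.d₆ + 1) (θ.ℓ₆ + 1)) (hK : Kpl i ((kGeo i).M * α₀) * (kGeo i).L ^ 4 < α₀')
    {U : CfgY (Matrix (Fin N) (Fin N) ℂ) i} (hU : regQY (specialUnitaryUnits (Fin N)) i c₀ α₀ U) :
    qKnitOfRecord N θ i U ∘ₗ gradY i U ∘ₗ GpPhysY i (parKnitY i) U ∘ₗ RY i (parKnitY i) (GpPhysY i (parKnitY i)) U = 0 :=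
  isNullOnQ_qKnitOfRecord unitBddY_specialUnitaryUnits specialUnitaryUnits_le_unitaryUnits hc i hMα hα' hα3 hα2 hK U hU

/-- ★★★ **(3.152) AND (3.124) FOR THE v11 KNIT RECORD'S OWN `G₁` AT `G := SU(N)` FROM (3.138) ALONE** (any residual family `𝔯`; print's units `c_f η = 1`):
`R D* G₁ = R G′ D*`, `G₁ D R = D G′ R`, `Q G₁ D R = 0`, `R D* G₁ Q† = 0`, `R D* G₁ D R = R` on the regime of record.
[cite: Balaban1985BackgroundPropagators, (3.152) p.426, (3.124) p.420, (3.115) p.418, (3.138) p.423, (3.24)–(3.25) p.394, (3.35) p.396] [cite: Balaban1985Averaging, Prop. 2 p.26, (15) p.19] -/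
theorem lettersYOfRecordV11K_ids3152_SU_of_regQY (𝔯 : ResY N θ Mstar) {c₀ α₀ : ℝ} (hc : c₀ ≤ 10) (x : MemberY θ.d₆ θ.ℓ₆ θ.hd' θ.hL' θ.b₀ θ.b₁ Mstar)
    (hMα : 0 ≤ (kGeo x.toKIdx).M * α₀) {α₀' : ℝ} (hα' : 0 < α₀') (hα3 : C0 (θ.d₆ + 1) * α₀' ≤ 1 / 3) (hα2 : 2 * α₀' ≤ c2' (θ.d₆ + 1) (θ.ℓ₆ + 1))
    (hK : Kpl x.toKIdx ((kGeo x.toKIdx).M * α₀) * (kGeo x.toKIdx).L ^ 4 < α₀') (hcf : x.toKIdx.cf * etaS x.toKIdx = 1)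
    {U : CfgY (Matrix (Fin N) (Fin N) ℂ) x.toKIdx} (hU : regQY (specialUnitaryUnits (Fin N)) x.toKIdx c₀ α₀ U)
    (hM1 : IsUnit (deltaOneQY x.toKIdx (qKnitOfRecord N θ x.toKIdx) (qsKnitOfRecord N θ x.toKIdx) (parKnitY x.toKIdx) (GpPhysY x.toKIdx (parKnitY x.toKIdx))
      (𝔯 x).Δ2 U)) :
    RY x.toKIdx (parKnitY x.toKIdx) (GpPhysY x.toKIdx (parKnitY x.toKIdx)) U ∘ₗ divY x.toKIdx U ∘ₗ (lettersYOfRecordV11K N θ Mstar 𝔯 x).G₁ U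
        = RY x.toKIdx (parKnitY x.toKIdx) (GpPhysY x.toKIdx (parKnitY x.toKIdx)) U ∘ₗ GpPhysY x.toKIdx (parKnitY x.toKIdx) U ∘ₗ divY x.toKIdx U
    ∧ (lettersYOfRecordV11K N θ Mstar 𝔯 x).G₁ U ∘ₗ gradY x.toKIdx U ∘ₗ RY x.toKIdx (parKnitY x.toKIdx) (GpPhysY x.toKIdx (parKnitY x.toKIdx)) U
        = gradY x.toKIdx U ∘ₗ GpPhysY x.toKIdx (parKnitY x.toKIdx) U ∘ₗ RY x.toKIdx (parKnitY x.toKIdx) (GpPhysY x.toKIdx (parKnitY x.toKIdx)) U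
    ∧ qKnitOfRecord N θ x.toKIdx U ∘ₗ (lettersYOfRecordV11K N θ Mstar 𝔯 x).G₁ U ∘ₗ gradY x.toKIdx U ∘ₗ
          RY x.toKIdx (parKnitY x.toKIdx) (GpPhysY x.toKIdx (parKnitY x.toKIdx)) U = 0
    ∧ RY x.toKIdx (parKnitY x.toKIdx) (GpPhysY x.toKIdx (parKnitY x.toKIdx)) U ∘ₗ divY x.toKIdx U ∘ₗ (lettersYOfRecordV11K N θ Mstar 𝔯 x).G₁ U ∘ₗ
          qsKnitOfRecord N θ x.toKIdx U = 0
    ∧ RY x.toKIdx (parKnitY x.toKIdx) (GpPhysY x.toKIdx (parKnitY x.toKIdx)) U ∘ₗ divY x.toKIdx U ∘ₗ (lettersYOfRecordV11K N θ Mstar 𝔯 x).G₁ U ∘ₗ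
          gradY x.toKIdx U ∘ₗ RY x.toKIdx (parKnitY x.toKIdx) (GpPhysY x.toKIdx (parKnitY x.toKIdx)) U
        = RY x.toKIdx (parKnitY x.toKIdx) (GpPhysY x.toKIdx (parKnitY x.toKIdx)) U :=
  lettersYOfRecordV11K_ids3152_of_regQY N θ Mstar 𝔯 unitBddY_specialUnitaryUnits specialUnitaryUnits_le_unitaryUnits hc x hMα hα' hα3
    hα2 hK hcf hU hM1

end AtRecord

end Literature.MathematicalPhysics.QuantumFieldTheory.Balaban1983to89.Node00
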